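import Summits.CriticalPhenomena.SAWScalingLimit.Theorems.SAWDevelopingMapObservableToSLECanonicalTransferInner
import Summits.CriticalPhenomena.SAWScalingLimit.Theorems.SAWDevelopingMapObservableToSLECanonicalTransferExhaustion
import Summits.CriticalPhenomena.SAWScalingLimit.Theorems.SAWDevelopingMapObservableToSLECanonicalTransferFloor
import HarnessLib

/-!
# Crux `SAWDevelopingMap.ObservableToSLE` (stmt-CriticalPhenomena-10472), line
`floor-ratio-restriction-bootstrap`, stub `stub_canonicalTransfer`: the inner admissible FAMILY
of a floor domain and the floor rows of the canonical endpoints (M1)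

Landing target:
`Summits/CriticalPhenomena/SAWScalingLimit/Theorems/SAWDevelopingMapObservableToSLECanonicalTransferFamily.lean`
(`--supports stmt-CriticalPhenomena-10472`).  Sequel of `…CanonicalTransferInner.lean` and
`…CanonicalTransferExhaustion.lean`.

* `row_le_iff_im` — rows versus heights of rescaled face centres;
* `exists_innerFamily` = registered sub-goal `stub_canonicalTransfer_family` — **the inner
  admissible family of ONE floor Jordan domain**: for all small `δ` the family is simply
  connected, connected and EXACTLY the component of the bulk vertex in the deep vertices; it
  exhausts the compacts and has exact floor rows near the floor points;
* `floor_row_unique`, `floor_row_spec` — the floor row `m = ⌊h/K + 2/3⌋`, `K = δ√3/2`;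
* `floor_endpoint_cases`, `floor_endpoint_data` — the two floor cases of a canonical endpoint
  (full lowest row / pendant) with the mid-edge `{o, i}` under it (`i` inner, `o` outer).
-/

noncomputable section

open scoped Topology
open Filter Set Metric
open Literature.Probability.LatticeModels (HexVertex hexGraph hexCenter Site)
open Literature.Probability.RandomPlanarGeometry
open Literature.Probability.RandomPlanarGeometry.SAW
open Literature.Probability.Percolation (PathIn)

namespace Summit.CriticalPhenomena.SAWScalingLimit.Theorems.ObservableToSLE.FloorRatio

/-! ### Floor rows -/

section Family

/-- **Rows versus heights**: `m ≤ row(u)` iff `Im(δ c_u) ≥ (m + 1/3) δ√3/2` (up-faces of row `x₁`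
sit at height `(x₁ + 1/3) δ√3/2`, down-faces at `(x₁ + 2/3) δ√3/2`). [folklore] -/
theorem row_le_iff_im {δ : ℝ} (hδ : 0 < δ) (m : ℤ) (u : HexVertex) :
    m ≤ u.1 1 ↔ ((m : ℝ) + 1 / 3) * (δ * (Real.sqrt 3 / 2)) ≤ ((δ : ℂ) * hexCenter u).im := by
  have hk : 0 < δ * (Real.sqrt 3 / 2) := by positivity
  rw [im_smul_hexCenter, show δ * (((u.1 1 : ℝ) + ((u.2 : ℕ) + 1) / 3) * (Real.sqrt 3 / 2)) =
    ((u.1 1 : ℝ) + ((u.2 : ℕ) + 1) / 3) * (δ * (Real.sqrt 3 / 2)) by ring,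
    mul_le_mul_iff_left₀ hk]
  have h2 : ((u.2 : ℕ) : ℝ) ≤ 1 := by
    have := u.2.isLt
    exact_mod_cast Nat.lt_succ_iff.1 this
  have h0 : (0 : ℝ) ≤ ((u.2 : ℕ) : ℝ) := Nat.cast_nonneg _
  constructor
  · intro hm
    have : (m : ℝ) ≤ u.1 1 := by exact_mod_cast hm
    linarith
  · intro hle
    by_contra hm
    push Not at hm
    have : (u.1 1 : ℝ) + 1 ≤ m := by exact_mod_cast hm
    linarith

/-- **The inner admissible family of a floor domain (M1, one domain).**  Let `Ω` be a bounded
Jordan-type domain (open, connected, connected exterior with frontier `∂Ω`) above the line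
`Im = h` and flat near the floor points `p₀`, `p₁` (`{Im > h} ∩ B(pᵢ, ρ) ⊆ Ω`); let `m δ` be the
floor row (`(m - 2/3) δ√3/2 ≤ h < (m + 1/3) δ√3/2`) and `v₀ δ` a bulk vertex within `δ` of
`p₀ + iρ/4`.  Then there are finite vertex sets `L δ` which, for all small `δ`, are simply
connected, connected and EXACTLY the `S_δ`-component of `v₀ δ`, `S_δ` the deep vertices
(`δ c_u ∈ Ω`, row `≥ m δ`, closed `25δ`-disc inside `Ω ∪ B(p₀, 3ρ/4) ∪ B(p₁, 3ρ/4)`); they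
eventually contain the lattice points of every compact `K ⊆ Ω` and have exact rows `≥ m δ` in
`B(pᵢ, ρ/16)`. [folklore] -/
theorem exists_innerFamily {Ω : Set ℂ} {h ρ : ℝ} {p₀ p₁ : ℂ} (hΩo : IsOpen Ω)
    (hΩc : IsConnected Ω) (hΩb : Bornology.IsBounded Ω) (hΩh : Ω ⊆ {z : ℂ | h < z.im})
    (hE : IsConnected (closure Ω)ᶜ) (hEfr : frontier (closure Ω)ᶜ = frontier Ω)
    (hp₀ : p₀.im = h) (hp₁ : p₁.im = h) (hρ : 0 < ρ)
    (hfl₀ : {z : ℂ | h < z.im} ∩ ball p₀ ρ ⊆ Ω) (hfl₁ : {z : ℂ | h < z.im} ∩ ball p₁ ρ ⊆ Ω)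
    {m : ℝ → ℤ} (hm : ∀ δ : ℝ, 0 < δ → ((m δ : ℝ) - 2 / 3) * (δ * (Real.sqrt 3 / 2)) ≤ h ∧
      h < ((m δ : ℝ) + 1 / 3) * (δ * (Real.sqrt 3 / 2)))
    {v₀ : ℝ → HexVertex}
    (hv₀ : ∀ δ : ℝ, 0 < δ → dist ((δ : ℂ) * hexCenter (v₀ δ)) (p₀ + (ρ / 4 : ℝ) * Complex.I) ≤ δ) :
    ∃ L : ℝ → Finset HexVertex,
      (∀ᶠ δ : ℝ in 𝓝[>] 0, hexDomainSimplyConnected (L δ) ∧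
        (hexGraph.induce (↑(L δ) : Set HexVertex)).Preconnected ∧
        ∀ z : HexVertex, z ∈ L δ ↔ PathIn hexGraph
          {u : HexVertex | (δ : ℂ) * hexCenter u ∈ Ω ∧ m δ ≤ u.1 1 ∧
            closedBall ((δ : ℂ) * hexCenter u) (25 * δ) ∩ {z : ℂ | h < z.im} ⊆ Ω ∪ ball p₀ (3 * ρ / 4) ∪ ball p₁ (3 * ρ / 4)}
          (v₀ δ) z) ∧
      (∀ K : Set ℂ, IsCompact K → K ⊆ Ω →
        ∀ᶠ δ : ℝ in 𝓝[>] 0, ∀ v : HexVertex, (δ : ℂ) * hexCenter v ∈ K → v ∈ L δ) ∧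
      (∀ᶠ δ : ℝ in 𝓝[>] 0, ∀ v : HexVertex, m δ ≤ v.1 1 →
        (δ : ℂ) * hexCenter v ∈ ball p₀ (ρ / 16) ∪ ball p₁ (ρ / 16) → v ∈ L δ) := by
  classical
  -- the deep sets, in height form
  set η : ℝ → ℝ := fun δ => ((m δ : ℝ) + 1 / 3) * (δ * (Real.sqrt 3 / 2)) with hη
  set S : ℝ → Set HexVertex := fun δ => {u : HexVertex | (δ : ℂ) * hexCenter u ∈ Ω ∧ m δ ≤ u.1 1 ∧
    closedBall ((δ : ℂ) * hexCenter u) (25 * δ) ∩ {z : ℂ | h < z.im} ⊆ Ω ∪ ball p₀ (3 * ρ / 4) ∪ ball p₁ (3 * ρ / 4)}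
    with hSdef
  have hS : ∀ δ : ℝ, 0 < δ → ∀ u, u ∈ S δ ↔ ((δ : ℂ) * hexCenter u ∈ Ω ∧
      η δ ≤ ((δ : ℂ) * hexCenter u).im ∧
      closedBall ((δ : ℂ) * hexCenter u) (25 * δ) ∩ {z : ℂ | h < z.im} ⊆ Ω ∪ ball p₀ (3 * ρ / 4) ∪ ball p₁ (3 * ρ / 4)) := by
    intro δ hδ u
    simp only [hSdef, mem_setOf_eq, row_le_iff_im hδ]
    exact Iff.rfl
  have hηh : ∀ δ : ℝ, 0 < δ → h < η δ := fun δ hδ => (hm δ hδ).2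
  have hηr : ∀ δ : ℝ, 0 < δ → η δ ≤ h + 25 * δ := by
    intro δ hδ
    have h1 := (hm δ hδ).1
    have hs : Real.sqrt 3 / 2 ≤ 1 := by
      rw [div_le_one (by norm_num : (0:ℝ) < 2)]
      have := Real.sqrt_le_sqrt (show (3:ℝ) ≤ 4 by norm_num)
      rwa [show (4:ℝ) = 2 ^ 2 by norm_num, Real.sqrt_sq (by norm_num : (0:ℝ) ≤ 2)] at this
    have h2 : δ * (Real.sqrt 3 / 2) ≤ δ := by nlinarith
    show ((m δ : ℝ) + 1 / 3) * (δ * (Real.sqrt 3 / 2)) ≤ h + 25 * δ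
    nlinarith
  -- a bound for `Ω`
  obtain ⟨R, hR0, hΩR⟩ := hΩb.subset_ball_lt 0 0
  have hR : ∀ z ∈ Ω, ‖z‖ < R := fun z hz => mem_ball_zero_iff.1 (hΩR hz)
  -- the inner finsets
  have hinner : ∀ δ : ℝ, 0 < δ ∧ δ ≤ ρ / 4 → ∃ Λ : Finset HexVertex, hexDomainSimplyConnected Λ ∧
      (hexGraph.induce (↑Λ : Set HexVertex)).Preconnected ∧
      ∀ z : HexVertex, z ∈ Λ ↔ PathIn hexGraph (S δ) (v₀ δ) z := fun δ hδ =>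
    exists_inner_finset hΩh hE hEfr hfl₀ hfl₁ (by linarith [hδ.2]) hδ.1 le_rfl hR0.le hR
      (hS δ hδ.1) (v₀ δ)
  refine ⟨fun δ => if hδ : 0 < δ ∧ δ ≤ ρ / 4 then (hinner δ hδ).choose else ∅, ?_, ?_, ?_⟩
  · filter_upwards [Ioc_mem_nhdsGT (show (0:ℝ) < ρ / 4 by positivity)] with δ hδ
    rw [dif_pos (show 0 < δ ∧ δ ≤ ρ / 4 from hδ)]
    exact (hinner δ hδ).choose_spec
  · -- exhaustion of compacts
    intro K hK hKΩ
    have hx₀ : p₀ + (ρ / 4 : ℝ) * Complex.I ∈ Ω := by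
      refine hfl₀ ⟨?_, ?_⟩
      · show h < (p₀ + (ρ / 4 : ℝ) * Complex.I).im
        simp [hp₀]; positivity
      · rw [mem_ball, dist_eq_norm, add_sub_cancel_left, norm_mul, Complex.norm_real, Complex.norm_I,
          mul_one, Real.norm_of_nonneg (by positivity)]
        linarith
    obtain ⟨ε, hε, hwalk⟩ := exists_walk_deep_of_isCompact hΩo hΩc hK hKΩ hx₀
    have hev : ∀ᶠ δ : ℝ in 𝓝[>] 0, δ ∈ Ioc 0 (min (ρ / 4) (ε / 29)) :=
      Ioc_mem_nhdsGT (lt_min (by positivity) (by positivity))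
    filter_upwards [hev] with δ hδ v hv
    have hδρ : 0 < δ ∧ δ ≤ ρ / 4 := ⟨hδ.1, hδ.2.trans (min_le_left _ _)⟩
    have hδε : δ ≤ ε / 29 := hδ.2.trans (min_le_right _ _)
    rw [dif_pos hδρ, (hinner δ hδρ).choose_spec.2.2]
    obtain ⟨q, hq⟩ := hwalk δ (25 * δ) hδ.1 (by linarith) (v₀ δ) v (hv₀ δ hδ.1) hv
    exact pathIn_of_deep_walk hΩh (by linarith) (hηr δ hδ.1) (hS δ hδ.1) q hq
  · -- exact rows near the floor points
    set K₀ : Set ℂ := closedBall (p₀ + (ρ / 4 : ℝ) * Complex.I) (ρ / 8) ∪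
      closedBall (p₁ + (ρ / 4 : ℝ) * Complex.I) (ρ / 8) with hK₀
    have hK₀c : IsCompact K₀ := (isCompact_closedBall _ _).union (isCompact_closedBall _ _)
    have hsub : ∀ {p : ℂ}, p.im = h → {z : ℂ | h < z.im} ∩ ball p ρ ⊆ Ω →
        closedBall (p + (ρ / 4 : ℝ) * Complex.I) (ρ / 8) ⊆ Ω := by
      intro p hp hfl z hz
      rw [mem_closedBall, dist_eq_norm] at hz
      refine hfl ⟨?_, ?_⟩
      · show h < z.im
        have h1 : (p + (ρ / 4 : ℝ) * Complex.I).im - z.im ≤ ‖z - (p + (ρ / 4 : ℝ) * Complex.I)‖ := by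
          rw [← norm_neg, neg_sub, ← Complex.sub_im]; exact Complex.im_le_norm _
        have h2 : (p + (ρ / 4 : ℝ) * Complex.I).im = h + ρ / 4 := by simp [hp]
        linarith
      · rw [mem_ball, dist_eq_norm]
        calc ‖z - p‖ = ‖(z - (p + (ρ / 4 : ℝ) * Complex.I)) + (ρ / 4 : ℝ) * Complex.I‖ := by
              congr 1; ring
          _ ≤ ‖z - (p + (ρ / 4 : ℝ) * Complex.I)‖ + ‖((ρ / 4 : ℝ) : ℂ) * Complex.I‖ := norm_add_le _ _
          _ ≤ ρ / 8 + ρ / 4 := by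
              refine add_le_add hz ?_
              rw [norm_mul, Complex.norm_real, Complex.norm_I, mul_one, Real.norm_of_nonneg (by positivity)]
          _ < ρ := by linarith
    have hK₀Ω : K₀ ⊆ Ω := union_subset (hsub hp₀ hfl₀) (hsub hp₁ hfl₁)
    have hx₀ : p₀ + (ρ / 4 : ℝ) * Complex.I ∈ Ω :=
      hsub hp₀ hfl₀ (mem_closedBall_self (by positivity))
    obtain ⟨ε, hε, hwalk⟩ := exists_walk_deep_of_isCompact hΩo hΩc hK₀c hK₀Ω hx₀
    have hev : ∀ᶠ δ : ℝ in 𝓝[>] 0, δ ∈ Ioc 0 (min (3 * ρ / 400) (ε / 29)) :=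
      Ioc_mem_nhdsGT (lt_min (by positivity) (by positivity))
    filter_upwards [hev] with δ hδ v hvm hvp
    have hδ1 : δ ≤ 3 * ρ / 400 := hδ.2.trans (min_le_left _ _)
    have hδρ : 0 < δ ∧ δ ≤ ρ / 4 := ⟨hδ.1, by linarith⟩
    have hδε : δ ≤ ε / 29 := hδ.2.trans (min_le_right _ _)
    rw [dif_pos hδρ, (hinner δ hδρ).choose_spec.2.2]
    have hKS : ∀ z : HexVertex, (δ : ℂ) * hexCenter z ∈ K₀ → PathIn hexGraph (S δ) (v₀ δ) z := by
      intro z hz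
      obtain ⟨q, hq⟩ := hwalk δ (25 * δ) hδ.1 (by linarith) (v₀ δ) z (hv₀ δ hδ.1) hz
      exact pathIn_of_deep_walk hΩh (by linarith) (hηr δ hδ.1) (hS δ hδ.1) q hq
    have hvη : η δ ≤ ((δ : ℂ) * hexCenter v).im := (row_le_iff_im hδ.1 (m δ) v).1 hvm
    rcases hvp with hvp | hvp
    · exact pathIn_of_near_floor_point (Or.inl rfl) hfl₀ (hηh δ hδ.1) hδ.1 (by linarith) hρ
        (by linarith) (hS δ hδ.1) (fun z hz => hKS z (Or.inl hz)) hvη (mem_ball.1 hvp)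
    · exact pathIn_of_near_floor_point (Or.inr rfl) hfl₁ (hηh δ hδ.1) hδ.1 (by linarith) hρ
        (by linarith) (hS δ hδ.1) (fun z hz => hKS z (Or.inr hz)) hvη (mem_ball.1 hvp)

end Family

/-! ### Floor rows and the canonical endpoints -/

section FloorRow

open Literature.Probability.LatticeModels (hexGraph_adj_iff_of_snd_eq_zero_holds
  hexGraph_adj_iff_of_snd_eq_one)

/-- **Uniqueness of the floor row**: the integer `m` with `(m - 2/3)K ≤ h < (m + 1/3)K` is unique.
[folklore] -/
theorem floor_row_unique {K h : ℝ} (hK : 0 < K) {m m' : ℤ}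
    (h1 : ((m : ℝ) - 2 / 3) * K ≤ h) (h2 : h < ((m : ℝ) + 1 / 3) * K)
    (h1' : ((m' : ℝ) - 2 / 3) * K ≤ h) (h2' : h < ((m' : ℝ) + 1 / 3) * K) : m = m' := by
  have a := lt_of_mul_lt_mul_right (h1.trans_lt h2') hK.le
  have b := lt_of_mul_lt_mul_right (h1'.trans_lt h2) hK.le
  have ha : m < m' + 1 := by
    have : (m : ℝ) < (m' : ℝ) + 1 := by linarith
    exact_mod_cast this
  have hb : m' < m + 1 := by
    have : (m' : ℝ) < (m : ℝ) + 1 := by linarith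
    exact_mod_cast this
  omega

/-- **The floor row function** `m = ⌊h/K + 2/3⌋` satisfies `(m - 2/3)K ≤ h < (m + 1/3)K`.
[folklore] -/
theorem floor_row_spec {K : ℝ} (hK : 0 < K) (h : ℝ) :
    ((⌊h / K + 2 / 3⌋ : ℝ) - 2 / 3) * K ≤ h ∧ h < ((⌊h / K + 2 / 3⌋ : ℝ) + 1 / 3) * K := by
  have h1 := Int.floor_le (h / K + 2 / 3)
  have h2 := Int.lt_floor_add_one (h / K + 2 / 3)
  constructor
  · have : (⌊h / K + 2 / 3⌋ : ℝ) - 2 / 3 ≤ h / K := by linarith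
    exact (le_div_iff₀ hK).1 this
  · have : h / K < (⌊h / K + 2 / 3⌋ : ℝ) + 1 / 3 := by linarith
    exact (div_lt_iff₀ hK).1 this

/-- The up-face `(x, 0)` is adjacent to the down-face `(x - e₁, 1)` vertically below it. [folklore] -/
theorem hexGraph_adj_below (x : Site 2) : hexGraph.Adj (x, (0 : Fin 2)) (x - Pi.single 1 1, 1) :=
  (hexGraph_adj_iff_of_snd_eq_zero_holds x _).2 (Or.inr (Or.inr rfl))

/-- The down-face `(x, 1)` is adjacent to the up-face `(x + e₁, 0)` vertically above it. [folklore] -/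
theorem hexGraph_adj_above (x : Site 2) : hexGraph.Adj (x, (1 : Fin 2)) (x + Pi.single 1 1, 0) :=
  (hexGraph_adj_iff_of_snd_eq_one x _).2 (Or.inr (Or.inr rfl))

/-- **The two floor cases of a canonical endpoint, with the floor row.**  If `a` (strictly above
the line `Im = h`) has a neighbour `u` on or below it and `m` is the floor row at mesh `δ`, then
either `a = (x, 0)` with `x₁ = m` and `u = (x - e₁, 1)`, or `a = (x, 1)` with `x₁ = m - 1`, the
up-faces of its row on or below the line. [folklore] -/
theorem floor_endpoint_cases {h δ : ℝ} (hδ : 0 < δ) {m : ℤ}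
    (hm1 : ((m : ℝ) - 2 / 3) * (δ * (Real.sqrt 3 / 2)) ≤ h)
    (hm2 : h < ((m : ℝ) + 1 / 3) * (δ * (Real.sqrt 3 / 2)))
    {a u : HexVertex} (hadj : hexGraph.Adj a u) (ha : h < ((δ : ℂ) * hexCenter a).im)
    (hu : ((δ : ℂ) * hexCenter u).im ≤ h) :
    (a.2 = 0 ∧ m = a.1 1 ∧ u = (a.1 - Pi.single 1 1, 1)) ∨
      (a.2 = 1 ∧ m = a.1 1 + 1 ∧ ((δ : ℂ) * hexCenter (a.1, (0 : Fin 2))).im ≤ h) := by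
  have hK : 0 < δ * (Real.sqrt 3 / 2) := by positivity
  have him : ∀ v : HexVertex, ((δ : ℂ) * hexCenter v).im =
      ((v.1 1 : ℝ) + ((v.2 : ℕ) + 1) / 3) * (δ * (Real.sqrt 3 / 2)) := fun v => by
    rw [im_smul_hexCenter]; ring
  rcases floor_neighbour_cases hδ hadj ha hu with ⟨ha0, rfl⟩ | ⟨ha1, hu'⟩
  · refine Or.inl ⟨ha0, floor_row_unique hK hm1 hm2 ?_ ?_, rfl⟩
    · rw [him] at hu
      simp only [Pi.sub_apply, Pi.single_eq_same, Int.cast_sub, Int.cast_one, Fin.val_one,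
        Nat.cast_one] at hu
      nlinarith
    · rw [him, ha0] at ha
      simp only [Fin.val_zero, Nat.cast_zero, zero_add] at ha
      linarith
  · have hx0 : ((δ : ℂ) * hexCenter (a.1, (0 : Fin 2))).im ≤ h := by
      rcases hu' with rfl | rfl
      · exact hu
      · rw [him] at hu ⊢
        simpa [Pi.add_apply] using hu
    refine Or.inr ⟨ha1, floor_row_unique hK hm1 hm2 ?_ ?_, hx0⟩
    · rw [him] at hx0
      simp only [Fin.val_zero, Nat.cast_zero, zero_add] at hx0
      push_cast
      linarith
    · rw [him, ha1] at ha
      simp only [Fin.val_one, Nat.cast_one] at ha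
      push_cast
      nlinarith

/-- **The mid-edge under a canonical endpoint.**  With `n = (x - e₁, 1)` below `a = (x, 0)` in the
full-row case and `n = (x + e₁, 0)` above `a = (x, 1)` in the pendant case, the mid-edge `{a, n}`
is `{o, i}` with `i` in the inner family `Λ'` (exact rows near the floor point `p`), `o ∉ Λ`, and
`o ∼ i`; together with the floor-matching clauses of the discretisation input. [folklore] -/
theorem floor_endpoint_data {Ω : Set ℂ} {h δ ρ' : ℝ} {p : ℂ} {m : ℤ} {Λ Λ' : Finset HexVertex}
    {a u : HexVertex} (hδ : 0 < δ)
    (hm1 : ((m : ℝ) - 2 / 3) * (δ * (Real.sqrt 3 / 2)) ≤ h)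
    (hm2 : h < ((m : ℝ) + 1 / 3) * (δ * (Real.sqrt 3 / 2)))
    (hadj : hexGraph.Adj a u) (ha : h < ((δ : ℂ) * hexCenter a).im)
    (hu : ((δ : ℂ) * hexCenter u).im ≤ h) (hΩh : Ω ⊆ {z : ℂ | h < z.im})
    (hΛ : ∀ v ∈ Λ, (δ : ℂ) * hexCenter v ∈ Ω ∧ m ≤ v.1 1)
    (hrows : ∀ v : HexVertex, m ≤ v.1 1 → (δ : ℂ) * hexCenter v ∈ ball p ρ' → v ∈ Λ')
    (hball : ∀ w : HexVertex, (w = a ∨ hexGraph.Adj a w) → (δ : ℂ) * hexCenter w ∈ ball p ρ') :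
    ∃ i o : HexVertex,
      s(a, if a.2 = 0 then ((a.1 - Pi.single 1 1, 1) : HexVertex) else (a.1 + Pi.single 1 1, 0)) =
        s(o, i) ∧ i ∈ Λ' ∧ o ∉ Λ ∧ hexGraph.Adj o i ∧ (i = a ∨ hexGraph.Adj a i) ∧
      (a.2 = 0 → m = a.1 1 ∧
        s(a, if a.2 = 0 then ((a.1 - Pi.single 1 1, 1) : HexVertex) else (a.1 + Pi.single 1 1, 0)) =
          s(a, ((a.1 - Pi.single 1 1, 1) : HexVertex))) ∧
      (a.2 = 1 → m = a.1 1 + 1 ∧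
        s(a, if a.2 = 0 then ((a.1 - Pi.single 1 1, 1) : HexVertex) else (a.1 + Pi.single 1 1, 0)) =
          s(((a.1 + Pi.single 1 1, 0) : HexVertex), a)) := by
  rcases floor_endpoint_cases hδ hm1 hm2 hadj ha hu with ⟨ha0, hm, rfl⟩ | ⟨ha1, hm, hx0⟩
  · rw [if_pos ha0]
    refine ⟨a, (a.1 - Pi.single 1 1, 1), Sym2.eq_swap, hrows a (hm ▸ le_rfl) (hball a (Or.inl rfl)),
      fun h' => ?_, hadj.symm, Or.inl rfl, fun _ => ⟨hm, rfl⟩, fun h' => ?_⟩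
    swap
    · rw [ha0] at h'; exact absurd h' (by decide)
    have := hΩh (hΛ _ h').1
    simp only [mem_setOf_eq] at this
    linarith
  · have h10 : ¬ (a.2 = 0) := by rw [ha1]; exact one_ne_zero
    rw [if_neg h10]
    have hadj' : hexGraph.Adj a (a.1 + Pi.single 1 1, 0) := by
      obtain ⟨x, k⟩ := a
      simp only at ha1
      subst ha1
      exact hexGraph_adj_above x
    refine ⟨(a.1 + Pi.single 1 1, 0), a, rfl, hrows _ ?_ (hball _ (Or.inr hadj')), fun h' => ?_,
      hadj', Or.inr hadj', fun h' => absurd h' h10, fun _ => ⟨hm, Sym2.eq_swap⟩⟩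
    · simp [Pi.add_apply, hm]
    · have := (hΛ a h').2
      omega


end FloorRow

/-- **Registered sub-goal `stub_canonicalTransfer_family`** (crux item stmt-CriticalPhenomena-10472,
line `floor-ratio-restriction-bootstrap`, stub `stub_canonicalTransfer`): uniqueness of the floor
row (registry form of `floor_row_unique`, the arithmetic heart of the floor matching). [folklore] -/
theorem stub_canonicalTransfer_family :
    ∀ (K h : ℝ) (m m' : ℤ), 0 < K → ((m : ℝ) - 2 / 3) * K ≤ h → h < ((m : ℝ) + 1 / 3) * K →
    ((m' : ℝ) - 2 / 3) * K ≤ h → h < ((m' : ℝ) + 1 / 3) * K → m = m' :=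
  fun _ _ _ _ hK h1 h2 h1' h2' => floor_row_unique hK h1 h2 h1' h2'

end Summit.CriticalPhenomena.SAWScalingLimit.Theorems.ObservableToSLE.FloorRatio

end
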